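import Mathlib
import Summits.FinalStateConjecture.FinalStateConjecture.Theses.LogTimeThreeAnnuli

/-!
# Route LogTimeThreeAnnuli — the support `DiscreteRenewal` (discrete renewal / Young lemma)

Support item `stmt-FinalStateConjecture-14486` of route `LogTimeThreeAnnuli` for the Final State
Conjecture: the discrete renewal (Young / Gronwall-with-memory) lemma behind the dyadic bookkeeping.

If `θ ≥ 0`, `K, g, δ : ℕ → ℝ` are nonnegative, `K` and `g` are summable, `θ + ∑ K < 1`, and
`δ (n+1) ≤ θ δ n + ∑_{j ≤ n} K (n-j) δ j + g n` for every `n`, then `δ` is summable and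
`∑ δ ≤ (δ 0 + ∑ g) / (1 - θ - ∑ K)`.

Proof (elementary real analysis over Mathlib): sum the recursion over `n < N`; the triangular
double sum `∑_{n<N} ∑_{j≤n} K (n-j) δ j` is, after exchanging the order of summation
(`Finset.sum_Ico_Ico_comm`), at most `(∑ K) ∑_{j<N} δ j`; this bounds the partial sums of `δ`
uniformly by `(δ 0 + ∑ g) / (1 - θ - ∑ K)`, and a nonnegative sequence with bounded partial sums is
summable with the same bound on its sum (`summable_of_sum_range_le`,
`Real.tsum_le_of_sum_range_le`). No literature facts are used.
-/

-- every `Summit.FinalStateConjecture.FinalStateConjecture.…` name repeats the summit = sub-problem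
-- segment (D-0017 layout, CONVENTIONS §2; lakefile sets it for the library build, a standalone
-- elaboration of this file does not see that option); the duplicate is deliberate.
set_option linter.dupNamespace false

namespace Summit.FinalStateConjecture.FinalStateConjecture.Theorems

/-- Exchange-of-summation bound for the discrete convolution with a nonnegative summable kernel:
for nonnegative `K`, `δ` with `K` summable and every `N`,
`∑_{n<N} ∑_{j≤n} K (n-j) δ j ≤ (∑' K) · ∑_{j<N} δ j`. -/
theorem discreteRenewal_conv_bound (K δ : ℕ → ℝ) (hK : ∀ n, 0 ≤ K n) (hδ : ∀ n, 0 ≤ δ n)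
    (hKs : Summable K) (N : ℕ) :
    ∑ n ∈ Finset.range N, ∑ j ∈ Finset.range (n + 1), K (n - j) * δ j
      ≤ (∑' n, K n) * ∑ j ∈ Finset.range N, δ j := by
  have hcomm : ∑ i ∈ Finset.Ico 0 N, ∑ j ∈ Finset.Ico i N, K (j - i) * δ i
      = ∑ j ∈ Finset.Ico 0 N, ∑ i ∈ Finset.Ico 0 (j + 1), K (j - i) * δ i :=
    Finset.sum_Ico_Ico_comm 0 N (fun i j => K (j - i) * δ i)
  simp only [Finset.range_eq_Ico]
  rw [← hcomm, Finset.mul_sum]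
  refine Finset.sum_le_sum fun i _ => ?_
  rw [← Finset.sum_mul]
  refine mul_le_mul_of_nonneg_right ?_ (hδ i)
  rw [Finset.sum_Ico_eq_sum_range]
  simp only [Nat.add_sub_cancel_left]
  exact hKs.sum_le_tsum _ (fun n _ => hK n)

open Summit.FinalStateConjecture.FinalStateConjecture.Theses.LogTimeThreeAnnuli in
/-- **Discrete renewal / Young lemma** (support item `stmt-FinalStateConjecture-14486` of route
`LogTimeThreeAnnuli`): for `θ ≥ 0`, nonnegative `K, g, δ : ℕ → ℝ` with `K`, `g` summable,
`θ + ∑' K < 1` and `δ (n+1) ≤ θ δ n + ∑_{j ≤ n} K (n-j) δ j + g n` for all `n`, the sequence `δ` is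
summable and `∑' δ ≤ (δ 0 + ∑' g) / (1 - θ - ∑' K)`. Summing the recursion over `n < N` and
exchanging the triangular double sum bounds every partial sum of `δ` by the right-hand side; a
nonnegative real sequence with bounded partial sums is summable with that bound. -/
theorem discreteRenewal_proof :
    Summit.FinalStateConjecture.FinalStateConjecture.Theses.LogTimeThreeAnnuli.DiscreteRenewal := by
  unfold DiscreteRenewal
  intro θ K g δ hθ hK hg hδ hKs hgs hlt hrec
  have hκ0 : 0 ≤ ∑' n, K n := tsum_nonneg hK
  have hpos : 0 < 1 - θ - ∑' n, K n := by linarith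
  -- uniform bound on the partial sums of `δ`
  have hbound : ∀ N, ∑ i ∈ Finset.range N, δ i ≤ (δ 0 + ∑' n, g n) / (1 - θ - ∑' n, K n) := by
    intro N
    rw [le_div_iff₀ hpos]
    -- the recursion summed over `n < N`
    have hsum : ∑ n ∈ Finset.range N, δ (n + 1)
        ≤ θ * ∑ n ∈ Finset.range N, δ n
          + (∑' n, K n) * ∑ n ∈ Finset.range N, δ n + ∑' n, g n := by
      calc ∑ n ∈ Finset.range N, δ (n + 1)
          ≤ ∑ n ∈ Finset.range N,
              (θ * δ n + (∑ j ∈ Finset.range (n + 1), K (n - j) * δ j) + g n) :=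
            Finset.sum_le_sum fun n _ => hrec n
        _ = θ * ∑ n ∈ Finset.range N, δ n
            + ∑ n ∈ Finset.range N, ∑ j ∈ Finset.range (n + 1), K (n - j) * δ j
            + ∑ n ∈ Finset.range N, g n := by
            rw [Finset.sum_add_distrib, Finset.sum_add_distrib, Finset.mul_sum]
        _ ≤ θ * ∑ n ∈ Finset.range N, δ n
            + (∑' n, K n) * ∑ n ∈ Finset.range N, δ n + ∑' n, g n := by
            have h1 := discreteRenewal_conv_bound K δ hK hδ hKs N
            have h2 : ∑ n ∈ Finset.range N, g n ≤ ∑' n, g n :=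
              hgs.sum_le_tsum _ (fun n _ => hg n)
            linarith
    -- `∑_{n<N} δ n ≤ ∑_{n<N+1} δ n = ∑_{n<N} δ (n+1) + δ 0`
    have hshift : ∑ n ∈ Finset.range N, δ n ≤ ∑ n ∈ Finset.range N, δ (n + 1) + δ 0 := by
      rw [← Finset.sum_range_succ']
      exact Finset.sum_le_sum_of_subset_of_nonneg (Finset.range_mono (Nat.le_succ N))
        (fun i _ _ => hδ i)
    have hS0 : 0 ≤ ∑ n ∈ Finset.range N, δ n := Finset.sum_nonneg fun i _ => hδ i
    nlinarith [hsum, hshift, hS0, hκ0, hθ]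
  exact ⟨summable_of_sum_range_le hδ hbound, Real.tsum_le_of_sum_range_le hδ hbound⟩

end Summit.FinalStateConjecture.FinalStateConjecture.Theorems
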